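import Literature.Probability.Distributions.LogConcaveSequences
import HarnessLib

/-!
# Efron's monotonicity theorem for sums of independent log-concave integer random variables

B. Efron, *Increasing properties of Pólya frequency functions*, Ann. Math. Statist. **36** (1965) 272–279 [Efron1965], Theorem 1
with the Remark on p. 278 (integer-valued variables); A. Saumard, J. A. Wellner, *Log-concavity and strong log-concavity: a review*,
Statist. Surveys **8** (2014) [SaumardWellner2014], Thm. 6.1 (statement), Rem. 6.2 (discrete case), Prop. 6.3 (the `m = 2 ⇒ m`
induction, which uses the stability of log-concavity under convolution).

**THEOREM (Efron).**  If `X_j` (`j ∈ κ`, finite) are independent random variables with values in `{0, …, N}` whose weights `w_j` are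
`PF₂` (log-concave, no internal zeros — `IsLogConcaveSeq`), and `Φ : (κ → {0,…,N}) → ℝ` is non-decreasing in each coordinate, then
`σ ↦ E[Φ(X) ∣ Σ_{j ∈ K} X_j = σ]` is non-decreasing (on the support of the block sum), for every set `K` of coordinates.

Everything is finite and DIVISION-FREE: with the product weight `piWeight N w y = Π_j w_j(y_j)` and the layer functional
`laySum N w K Φ σ = Σ_{y : Σ_{j∈K} y_j = σ} Π_j w_j(y_j)·Φ(y)`, the theorem reads
`laySum Φ σ · laySum 1 σ' ≤ laySum Φ σ' · laySum 1 σ` for `σ ≤ σ'` (`efron_laySum_mul_le`).  Corollaries: the law of the block sum is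
`PF₂` (`isLogConcaveSeq_laySum_one`), and the covariance ("Chebyshev") form under an arbitrary nonnegative reweighting `ω` of the
block sum, `E_ω[Φ ∣ S < c] ≤ E_ω[Φ]` cross-multiplied (`efron_prefix_mul_le`).

PROOF (Efron's, made elementary).  Two variables (`efron_two_step`): the layer laws of `X` given `X + S = σ` and `= σ + 1` satisfy
`Law(X ∣ σ) ≼ Law(X ∣ σ+1) ≼ Law(X + 1 ∣ σ)` (monotone likelihood ratios from the log-concavity of the law of `S`, resp. of `X`;
`sum_range_mul_sum_le_of_mlr`), and a function increasing along both unit moves has larger mean under the middle law — proved by a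
summation-by-parts induction (`sandwich_sum_le`) instead of the quantile coupling `X ≤ X' ≤ X + 1`.  General `K` by induction on `K`
(`efron_aux`): peel one coordinate `i` (`laySum_insert`, a slice identity on the product space), apply the two-variable step to
`(X_i, Σ_{K} X_j)` with the conditional means of the sections `Φ(· with y_i := x)` (induction hypothesis), and carry along that the
layer masses of the block sum are `PF₂` (`isLogConcaveSeq_seqConv` from `LogConcaveSequences.lean`).  Consecutive layers are chained
along the interval support (`IsLogConcaveSeq.pos_of_mem_Icc`).

Not here: continuous (density) versions, `PF_n` generalisations [Oudghiri, Statist. Probab. Lett. 2021], strong log-concavity.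
Used by `Summits/CriticalPhenomena/PercolationContinuityZ3/Theorems/PercNearOneGluingNoHeavyLowerTailSahiOneStepProfileGrid.lean`.
-/

namespace Literature.Probability.Distributions

open Finset Function

/-! ## Two finite-sum lemmas -/

/-- Monotone likelihood ratio ⇒ the prefix sums are dominated (cross-multiplied form): if `Q y · P y' ≤ Q y' · P y` for
`y < x ≤ y'`, then `(Σ_{y<x} Q)(Σ_{y≤M} P) ≤ (Σ_{y<x} P)(Σ_{y≤M} Q)`. [folklore] -/
private theorem sum_range_mul_sum_le_of_mlr (P Q : ℕ → ℝ) {x M : ℕ} (hx : x ≤ M + 1)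
    (h : ∀ y y', y < x → x ≤ y' → y' ≤ M → Q y * P y' ≤ Q y' * P y) :
    (∑ y ∈ range x, Q y) * (∑ y ∈ range (M + 1), P y) ≤ (∑ y ∈ range x, P y) * (∑ y ∈ range (M + 1), Q y) := by
  rw [← sum_range_add_sum_Ico P hx, ← sum_range_add_sum_Ico Q hx, mul_add, mul_add, mul_comm (∑ y ∈ range x, Q y) (∑ y ∈ range x, P y),
    add_le_add_iff_left, sum_mul_sum, sum_mul_sum]
  refine sum_le_sum fun y hy => sum_le_sum fun y' hy' => ?_
  rw [mem_Ico] at hy'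
  exact (h y y' (mem_range.1 hy) hy'.1 (by omega)).trans_eq (mul_comm _ _)

/-- **The sandwich lemma.**  Let `P` and `Q` be weights on `ℕ` with `Σ_{y<n} Q ≤ Σ_{y<n} P ≤ Σ_{y≤n} Q` for all `n` (the law `Q`
lies stochastically between `P` and `P` shifted up by one), and let `ψ₁ x ≤ ψ₂ x`, `ψ₁ x ≤ ψ₂ (x+1)` wherever the relevant weights are
positive.  Then `Σ_{x<n} Q ψ₂ − Σ_{x<n} P ψ₁ ≥ (Σ_{x<n} Q − Σ_{x<n} P)·ψ₂ n` for every `n` (so `Σ P ψ₁ ≤ Σ Q ψ₂` once the total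
masses agree).  This is the bookkeeping behind the quantile coupling `X ≤ X' ≤ X + 1`. [folklore] -/
private theorem sandwich_sum_le (P Q ψ₁ ψ₂ : ℕ → ℝ)
    (hF1 : ∀ n, ∑ y ∈ range n, Q y ≤ ∑ y ∈ range n, P y)
    (hF2 : ∀ n, ∑ y ∈ range n, P y ≤ ∑ y ∈ range (n + 1), Q y)
    (hψa : ∀ x, 0 < P x → 0 < Q x → ψ₁ x ≤ ψ₂ x)
    (hψb : ∀ x, 0 < P x → 0 < Q (x + 1) → ψ₁ x ≤ ψ₂ (x + 1)) (n : ℕ) :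
    ((∑ y ∈ range n, Q y) - ∑ y ∈ range n, P y) * ψ₂ n ≤
      (∑ x ∈ range n, Q x * ψ₂ x) - ∑ x ∈ range n, P x * ψ₁ x := by
  induction n with
  | zero => simp
  | succ n ih =>
    rw [sum_range_succ, sum_range_succ, sum_range_succ, sum_range_succ]
    set FQ := ∑ y ∈ range n, Q y with hFQ
    set FP := ∑ y ∈ range n, P y with hFP
    -- `α = F_Q(n+1) − F_P(n) ∈ [0, P n]`
    have hα0 : 0 ≤ FQ + Q n - FP := by have := hF2 n; rw [sum_range_succ] at this; linarith
    have hα1 : FQ + Q n - FP ≤ P n := by have := hF1 (n + 1); rw [sum_range_succ, sum_range_succ] at this; linarith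
    have hQn : FQ + Q n - FP ≤ Q n := by have := hF1 n; linarith
    have hQn1 : P n - (FQ + Q n - FP) ≤ Q (n + 1) := by
      have := hF2 (n + 1); rw [sum_range_succ, sum_range_succ, sum_range_succ] at this; linarith
    -- the two nonnegative terms
    have t1 : 0 ≤ (FQ + Q n - FP) * (ψ₂ n - ψ₁ n) := by
      rcases hα0.lt_or_eq with hpos | hzero
      · exact mul_nonneg hα0 (sub_nonneg.2 (hψa n (lt_of_lt_of_le hpos hα1) (lt_of_lt_of_le hpos hQn)))
      · rw [← hzero, zero_mul]
    have t2 : 0 ≤ (P n - (FQ + Q n - FP)) * (ψ₂ (n + 1) - ψ₁ n) := by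
      rcases (sub_nonneg.2 hα1).lt_or_eq with hpos | hzero
      · exact mul_nonneg (sub_nonneg.2 hα1) (sub_nonneg.2 (hψb n (by linarith) (lt_of_lt_of_le hpos hQn1)))
      · rw [← hzero, zero_mul]
    nlinarith [t1, t2, ih]

/-! ## The two-variable step (Efron's lemma in cross-multiplied form) -/

/-- **Efron's two-variable step**, division-free.  `f` is the `PF₂` weight of a variable `X`, `n` the `PF₂` layer masses of an
independent family `S` (`n u = P(S = u)` up to a constant), and `A x u` plays `n u · E[Φ(x, ·) ∣ S = u]` for a function `Φ` that is
non-decreasing in `x` (`hAx`) and has non-decreasing conditional means in `u` (`hAu`, cross-multiplied).  Then the conditional mean of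
`Φ(X, ·)` given `X + S = σ` is at most the one given `X + S = σ + 1`:
`(Σ_{x≤σ} f x A x (σ−x))·(Σ_{x≤σ+1} f x n (σ+1−x)) ≤ (Σ_{x≤σ+1} f x A x (σ+1−x))·(Σ_{x≤σ} f x n (σ−x))`.
[cite: Efron1965, Thm 1 (case `n = 2`); SaumardWellner2014, Thm 6.1] -/
theorem efron_two_step {f n : ℕ → ℝ} (A : ℕ → ℕ → ℝ) (hf : IsLogConcaveSeq f) (hn : IsLogConcaveSeq n)
    (hAz : ∀ x u, n u = 0 → A x u = 0)
    (hAu : ∀ x u u', u ≤ u' → A x u * n u' ≤ A x u' * n u) (hAx : ∀ x x' u, x ≤ x' → A x u ≤ A x' u) (σ : ℕ) :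
    (∑ x ∈ range (σ + 1), f x * A x (σ - x)) * (∑ x ∈ range (σ + 2), f x * n (σ + 1 - x)) ≤
      (∑ x ∈ range (σ + 2), f x * A x (σ + 1 - x)) * (∑ x ∈ range (σ + 1), f x * n (σ - x)) := by
  -- the two layer laws (unnormalised) and their total masses
  set p : ℕ → ℝ := fun x => if x ≤ σ then f x * n (σ - x) else 0 with hp
  set q : ℕ → ℝ := fun x => if x ≤ σ + 1 then f x * n (σ + 1 - x) else 0 with hq
  set Cp : ℝ := ∑ x ∈ range (σ + 1), f x * n (σ - x) with hCp
  set Cq : ℝ := ∑ x ∈ range (σ + 2), f x * n (σ + 1 - x) with hCq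
  have hp0 : ∀ x, 0 ≤ p x := fun x => by simp only [hp]; split_ifs <;> [exact mul_nonneg (hf.1 x) (hn.1 _); exact le_rfl]
  have hq0 : ∀ x, 0 ≤ q x := fun x => by simp only [hq]; split_ifs <;> [exact mul_nonneg (hf.1 x) (hn.1 _); exact le_rfl]
  have hCp0 : 0 ≤ Cp := sum_nonneg fun x _ => mul_nonneg (hf.1 x) (hn.1 _)
  have hCq0 : 0 ≤ Cq := sum_nonneg fun x _ => mul_nonneg (hf.1 x) (hn.1 _)
  -- prefix sums of `p`, `q` saturate at their supports
  have sum_p : ∀ m, σ + 1 ≤ m → ∑ y ∈ range m, p y = Cp := by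
    intro m hm
    rw [← sum_range_add_sum_Ico p hm, sum_eq_zero (s := Ico (σ + 1) m) (fun y hy => by
      rw [mem_Ico] at hy; simp only [hp]; rw [if_neg (by omega)]), add_zero]
    exact sum_congr rfl fun y hy => by simp only [hp]; rw [if_pos (by have := mem_range.1 hy; omega)]
  have sum_q : ∀ m, σ + 2 ≤ m → ∑ y ∈ range m, q y = Cq := by
    intro m hm
    rw [← sum_range_add_sum_Ico q hm, sum_eq_zero (s := Ico (σ + 2) m) (fun y hy => by
      rw [mem_Ico] at hy; simp only [hq]; rw [if_neg (by omega)]), add_zero]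
    exact sum_congr rfl fun y hy => by simp only [hq]; rw [if_pos (by have := mem_range.1 hy; omega)]
  have p_of_le : ∀ y, y ≤ σ → p y = f y * n (σ - y) := fun y hy => by simp only [hp]; rw [if_pos hy]
  have q_of_le : ∀ y, y ≤ σ + 1 → q y = f y * n (σ + 1 - y) := fun y hy => by simp only [hq]; rw [if_pos hy]
  have p_of_gt : ∀ y, σ < y → p y = 0 := fun y hy => by simp only [hp]; rw [if_neg (by omega)]
  have q_of_gt : ∀ y, σ + 1 < y → q y = 0 := fun y hy => by simp only [hq]; rw [if_neg (by omega)]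
  -- (F1) `q/p` is non-decreasing (log-concavity of `n`): prefix sums of `q·Cp` are below those of `p·Cq`
  have mlr1 : ∀ y y', y ≤ y' → q y * p y' ≤ q y' * p y := by
    intro y y' hyy'
    by_cases hy' : y' ≤ σ
    · rw [p_of_le y' hy', p_of_le y (by omega), q_of_le y (by omega), q_of_le y' (by omega)]
      have key := hn.mul_le_mul (a := σ - y') (b := σ + 1 - y') (c := σ - y) (d := σ + 1 - y) (by omega) (by omega) (by omega)
      have := mul_le_mul_of_nonneg_left key (mul_nonneg (hf.1 y) (hf.1 y'))
      nlinarith [this]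
    · rw [p_of_gt y' (by omega), mul_zero]; exact mul_nonneg (hq0 _) (hp0 _)
  have F1 : ∀ m, (∑ y ∈ range m, q y) * Cp ≤ (∑ y ∈ range m, p y) * Cq := by
    intro m
    rcases le_or_gt m (σ + 2) with hm | hm
    · have h := sum_range_mul_sum_le_of_mlr p q (x := m) (M := σ + 1) hm (fun y y' _ _ _ => mlr1 y y' (by omega))
      rwa [sum_p (σ + 2) (by omega), sum_q (σ + 2) le_rfl] at h
    · rw [sum_p m (by omega), sum_q m (by omega), mul_comm]
  -- (F2) `p(·−1)/q` is non-decreasing (log-concavity of `f`): prefix sums of `p·Cq`, shifted by one, are below those of `q·Cp`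
  set p' : ℕ → ℝ := fun y => if y = 0 then 0 else p (y - 1) with hp'
  have hp'0 : ∀ y, 0 ≤ p' y := fun y => by simp only [hp']; split_ifs <;> [exact le_rfl; exact hp0 _]
  have sum_p' : ∀ m, ∑ y ∈ range (m + 1), p' y = ∑ y ∈ range m, p y := by
    intro m
    rw [sum_range_succ']
    simp only [hp', if_true, add_zero, Nat.succ_ne_zero, if_false, Nat.add_sub_cancel]
  have mlr2 : ∀ y y', y ≤ y' → p' y * q y' ≤ p' y' * q y := by
    intro y y' hyy'
    rcases Nat.eq_zero_or_pos y with rfl | hy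
    · simp only [hp', if_true, zero_mul]; exact mul_nonneg (hp'0 _) (hq0 _)
    · have hy' : y' ≠ 0 := by omega
      simp only [hp', if_neg hy.ne', if_neg hy']
      by_cases hyσ : y' ≤ σ + 1
      · rw [p_of_le (y - 1) (by omega), p_of_le (y' - 1) (by omega), q_of_le y (by omega), q_of_le y' hyσ,
          show σ - (y - 1) = σ + 1 - y from by omega, show σ - (y' - 1) = σ + 1 - y' from by omega]
        have key := hf.mul_le_mul (a := y - 1) (b := y) (c := y' - 1) (d := y') (by omega) hyy' (by omega)
        have := mul_le_mul_of_nonneg_left key (mul_nonneg (hn.1 (σ + 1 - y)) (hn.1 (σ + 1 - y')))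
        nlinarith [this]
      · rw [q_of_gt y' (by omega), mul_zero]; exact mul_nonneg (hp0 _) (hq0 _)
  have F2 : ∀ m, (∑ y ∈ range m, p y) * Cq ≤ (∑ y ∈ range (m + 1), q y) * Cp := by
    intro m
    rcases le_or_gt (m + 1) (σ + 2) with hm | hm
    · have h := sum_range_mul_sum_le_of_mlr q p' (x := m + 1) (M := σ + 1) hm (fun y y' _ _ _ => mlr2 y y' (by omega))
      rwa [sum_p', sum_p', sum_q (σ + 2) le_rfl, sum_p (σ + 1) le_rfl] at h
    · rw [sum_p m (by omega), sum_q (m + 1) (by omega), mul_comm]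
  -- the conditional means
  set ψ₁ : ℕ → ℝ := fun x => A x (σ - x) / n (σ - x) with hψ₁
  set ψ₂ : ℕ → ℝ := fun x => A x (σ + 1 - x) / n (σ + 1 - x) with hψ₂
  have key := sandwich_sum_le (fun x => p x * Cq) (fun x => q x * Cp) ψ₁ ψ₂
    (fun m => by rw [← sum_mul, ← sum_mul]; exact F1 m) (fun m => by rw [← sum_mul, ← sum_mul]; exact F2 m)
    (fun x hpx hqx => by
      -- `x ≤ σ`, `f x > 0`, `n (σ−x) > 0`, `n (σ+1−x) > 0`
      have hxσ : x ≤ σ := by by_contra h; rw [p_of_gt x (by omega), zero_mul] at hpx; exact lt_irrefl 0 hpx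
      rw [p_of_le x hxσ] at hpx; rw [q_of_le x (by omega)] at hqx
      have hn1 : 0 < n (σ - x) := by
        rcases (hn.1 (σ - x)).lt_or_eq with h | h; exact h; rw [← h, mul_zero, zero_mul] at hpx; exact absurd hpx (lt_irrefl 0)
      have hn2 : 0 < n (σ + 1 - x) := by
        rcases (hn.1 (σ + 1 - x)).lt_or_eq with h | h; exact h; rw [← h, mul_zero, zero_mul] at hqx; exact absurd hqx (lt_irrefl 0)
      simp only [hψ₁, hψ₂]
      rw [div_le_div_iff₀ hn1 hn2]
      exact hAu x _ _ (by omega))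
    (fun x hpx hqx => by
      have hxσ : x ≤ σ := by by_contra h; rw [p_of_gt x (by omega), zero_mul] at hpx; exact lt_irrefl 0 hpx
      rw [p_of_le x hxσ] at hpx
      have hn1 : 0 < n (σ - x) := by
        rcases (hn.1 (σ - x)).lt_or_eq with h | h; exact h; rw [← h, mul_zero, zero_mul] at hpx; exact absurd hpx (lt_irrefl 0)
      simp only [hψ₁, hψ₂]
      rw [show σ + 1 - (x + 1) = σ - x from by omega]
      exact div_le_div_of_nonneg_right (hAx x (x + 1) _ (by omega)) hn1.le)
    (σ + 2)
  -- evaluate the sums in `key`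
  have eQ : ∑ x ∈ range (σ + 2), q x * Cp = Cq * Cp := by rw [← sum_mul, sum_q (σ + 2) le_rfl]
  have eP : ∑ x ∈ range (σ + 2), p x * Cq = Cp * Cq := by rw [← sum_mul, sum_p (σ + 2) (by omega)]
  have eval : ∀ (x u : ℕ), f x * n u * (A x u / n u) = f x * A x u := by
    intro x u
    by_cases h : n u = 0
    · rw [hAz x u h, h]; simp
    · field_simp
  have e1 : ∑ x ∈ range (σ + 2), p x * Cq * ψ₁ x = Cq * ∑ x ∈ range (σ + 1), f x * A x (σ - x) := by
    rw [sum_range_succ, p_of_gt (σ + 1) (by omega), zero_mul, zero_mul, add_zero, mul_sum]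
    refine sum_congr rfl fun x hx => ?_
    rw [p_of_le x (by have := mem_range.1 hx; omega)]; simp only [hψ₁]; rw [← eval x (σ - x)]; ring
  have e2 : ∑ x ∈ range (σ + 2), q x * Cp * ψ₂ x = Cp * ∑ x ∈ range (σ + 2), f x * A x (σ + 1 - x) := by
    rw [mul_sum]
    refine sum_congr rfl fun x hx => ?_
    rw [q_of_le x (by have := mem_range.1 hx; omega)]; simp only [hψ₂]; rw [← eval x (σ + 1 - x)]; ring
  rw [eQ, eP, e1, e2, show Cq * Cp - Cp * Cq = 0 from by ring, zero_mul] at key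
  nlinarith [key]


/-! ## Product weights on `κ → Fin (N+1)` and the layer functional -/

section Multi

variable {κ : Type*} [Fintype κ] [DecidableEq κ]

/-- The product weight `Π_j w_j(y_j)` of a configuration `y : κ → {0,…,N}` (independent coordinates with weights `w_j`).
[cite: Efron1965, Thm 1; SaumardWellner2014, Thm 6.1] -/
def piWeight (N : ℕ) (w : κ → ℕ → ℝ) (y : κ → Fin (N + 1)) : ℝ := ∏ j, w j (y j)

/-- The block sum `Σ_{j ∈ K} y_j`. [cite: Efron1965, Thm 1; SaumardWellner2014, Thm 6.1] -/
def blockSum {N : ℕ} (K : Finset κ) (y : κ → Fin (N + 1)) : ℕ := ∑ j ∈ K, (y j : ℕ)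

/-- The layer functional `L_K(Φ, σ) = Σ_{y : Σ_{j∈K} y_j = σ} Π_j w_j(y_j) · Φ(y)`; `L_K(1, σ)` is the (unnormalised) law of the block
sum and `L_K(Φ, σ)/L_K(1, σ)` the conditional expectation of `Φ` given the block sum. [cite: Efron1965, Thm 1; SaumardWellner2014, Thm 6.1] -/
def laySum (N : ℕ) (w : κ → ℕ → ℝ) (K : Finset κ) (Φ : (κ → Fin (N + 1)) → ℝ) (σ : ℕ) : ℝ :=
  ∑ y : κ → Fin (N + 1), if blockSum K y = σ then piWeight N w y * Φ y else 0

variable {N : ℕ}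

/-- Unfolding `laySum`. [cite: Efron1965, Thm 1; SaumardWellner2014, Thm 6.1] -/
theorem laySum_def (w : κ → ℕ → ℝ) (K : Finset κ) (Φ : (κ → Fin (N + 1)) → ℝ) (σ : ℕ) :
    laySum N w K Φ σ = ∑ y : κ → Fin (N + 1), if blockSum K y = σ then piWeight N w y * Φ y else 0 := rfl

omit [DecidableEq κ] in
/-- The product weight of nonnegative weights is nonnegative. [folklore] -/
private theorem piWeight_nonneg {w : κ → ℕ → ℝ} (hw : ∀ j n, 0 ≤ w j n) (y : κ → Fin (N + 1)) : 0 ≤ piWeight N w y :=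
  Finset.prod_nonneg fun j _ => hw j _

/-- `L_K` is linear in `Φ`: subtracting a constant. [folklore] -/
private theorem laySum_sub_const (w : κ → ℕ → ℝ) (K : Finset κ) (Φ : (κ → Fin (N + 1)) → ℝ) (c : ℝ) (σ : ℕ) :
    laySum N w K (fun y => Φ y - c) σ = laySum N w K Φ σ - c * laySum N w K (fun _ => 1) σ := by
  unfold laySum
  rw [mul_sum, ← sum_sub_distrib]
  refine sum_congr rfl fun y _ => ?_
  split_ifs <;> ring

/-- `L_K` is monotone in `Φ` for nonnegative weights. [folklore] -/
private theorem laySum_mono {w : κ → ℕ → ℝ} (hw : ∀ j n, 0 ≤ w j n) (K : Finset κ) {Φ Ψ : (κ → Fin (N + 1)) → ℝ}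
    (h : ∀ y, Φ y ≤ Ψ y) (σ : ℕ) : laySum N w K Φ σ ≤ laySum N w K Ψ σ :=
  sum_le_sum fun y _ => by
    split_ifs
    · exact mul_le_mul_of_nonneg_left (h y) (piWeight_nonneg hw y)
    · exact le_rfl

/-- `L_K(Φ, σ) ≥ 0` for `Φ ≥ 0`. [folklore] -/
private theorem laySum_nonneg {w : κ → ℕ → ℝ} (hw : ∀ j n, 0 ≤ w j n) (K : Finset κ) {Φ : (κ → Fin (N + 1)) → ℝ}
    (h : ∀ y, 0 ≤ Φ y) (σ : ℕ) : 0 ≤ laySum N w K Φ σ :=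
  sum_nonneg fun y _ => by
    split_ifs
    · exact mul_nonneg (piWeight_nonneg hw y) (h y)
    · exact le_rfl

/-- An empty layer carries no `Φ`-mass: `L_K(1, σ) = 0 ⇒ L_K(Φ, σ) = 0`. [folklore] -/
private theorem laySum_eq_zero_of_one {w : κ → ℕ → ℝ} (hw : ∀ j n, 0 ≤ w j n) (K : Finset κ) (Φ : (κ → Fin (N + 1)) → ℝ)
    {σ : ℕ} (h0 : laySum N w K (fun _ => 1) σ = 0) : laySum N w K Φ σ = 0 := by
  unfold laySum at h0 ⊢
  have hterm := (sum_eq_zero_iff_of_nonneg (fun y _ => by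
    split_ifs <;> [exact mul_nonneg (piWeight_nonneg hw y) zero_le_one; exact le_rfl])).1 h0
  refine sum_eq_zero fun y hy => ?_
  have := hterm y hy
  split_ifs with hy'
  · rw [if_pos hy', mul_one] at this; rw [this, zero_mul]
  · rfl

omit [Fintype κ] in
/-- The block sum over `K` does not see a coordinate `i ∉ K`. [folklore] -/
private theorem blockSum_update_of_not_mem {K : Finset κ} {i : κ} (hi : i ∉ K) (y : κ → Fin (N + 1)) (v : Fin (N + 1)) :
    blockSum K (update y i v) = blockSum K y := by
  unfold blockSum
  exact sum_congr rfl fun j hj => by rw [update_of_ne (ne_of_mem_of_not_mem hj hi)]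

/-! ### Slicing along one coordinate -/

/-- The product weight with the `i`-th factor removed. [folklore] -/
private def piWeightErase (N : ℕ) (w : κ → ℕ → ℝ) (i : κ) (y : κ → Fin (N + 1)) : ℝ := ∏ j ∈ univ.erase i, w j (y j)

/-- `Π_j w_j(y_j) = w_i(y_i) · Π_{j ≠ i} w_j(y_j)`. [folklore] -/
private theorem piWeight_eq_mul_erase (w : κ → ℕ → ℝ) (i : κ) (y : κ → Fin (N + 1)) :
    piWeight N w y = w i (y i) * piWeightErase N w i y := by
  unfold piWeight piWeightErase
  rw [← Finset.mul_prod_erase univ (fun j => w j (y j)) (mem_univ i)]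

/-- The erased weight does not see the `i`-th coordinate. [folklore] -/
private theorem piWeightErase_update (w : κ → ℕ → ℝ) (i : κ) (y : κ → Fin (N + 1)) (v : Fin (N + 1)) :
    piWeightErase N w i (update y i v) = piWeightErase N w i y := by
  unfold piWeightErase
  exact prod_congr rfl fun j hj => by rw [update_of_ne (ne_of_mem_erase hj)]

/-- Fibre sums over `{y : y_i = v}` of an `i`-invariant function do not depend on `v`. [folklore] -/
private theorem sum_fibre_eq (i : κ) (G : (κ → Fin (N + 1)) → ℝ) (hG : ∀ y v, G (update y i v) = G y) (v v' : Fin (N + 1)) :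
    ∑ y, (if y i = v then G y else 0) = ∑ y, (if y i = v' then G y else 0) := by
  rw [← sum_filter, ← sum_filter]
  refine sum_nbij' (fun y => update y i v') (fun y => update y i v) ?_ ?_ ?_ ?_ ?_
  · intro y _; simp only [mem_filter, mem_univ, true_and, update_self]
  · intro y _; simp only [mem_filter, mem_univ, true_and, update_self]
  · intro y hy
    simp only [mem_filter, mem_univ, true_and] at hy
    rw [update_idem, ← hy, update_eq_self]
  · intro y hy
    simp only [mem_filter, mem_univ, true_and] at hy
    rw [update_idem, ← hy, update_eq_self]
  · intro y _; exact (hG y v').symm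

/-- **Slice identity.**  For `h` not depending on the `i`-th coordinate:
`(Σ_v w_i v) · Σ_{y : y_i = x} Π w(y) h(y) = w_i(x) · Σ_y Π w(y) h(y)`. [folklore] -/
private theorem slice_sum (w : κ → ℕ → ℝ) (i : κ) (h : (κ → Fin (N + 1)) → ℝ) (hh : ∀ y v, h (update y i v) = h y)
    (x : Fin (N + 1)) :
    (∑ v : Fin (N + 1), w i v) * ∑ y, (if y i = x then piWeight N w y * h y else 0) =
      w i x * ∑ y, piWeight N w y * h y := by
  -- fibre sums of the erased weight are all equal to `S`
  set S : ℝ := ∑ y, (if y i = x then piWeightErase N w i y * h y else 0) with hS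
  have fib : ∀ v : Fin (N + 1), ∑ y, (if y i = v then piWeight N w y * h y else 0) = w i v * S := by
    intro v
    rw [hS, sum_fibre_eq i (fun y => piWeightErase N w i y * h y) (fun y u => by
      simp only [piWeightErase_update, hh]) x v, mul_sum]
    refine sum_congr rfl fun y _ => ?_
    split_ifs with hy
    · rw [piWeight_eq_mul_erase w i y, hy]; ring
    · rw [mul_zero]
  have tot : ∑ y, piWeight N w y * h y = ∑ v : Fin (N + 1), w i v * S := by
    rw [← Finset.sum_fiberwise univ (fun y : κ → Fin (N + 1) => y i) (fun y => piWeight N w y * h y)]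
    refine sum_congr rfl fun v _ => ?_
    rw [sum_filter]; exact fib v
  rw [fib x, tot, ← sum_mul]
  ring

/-! ### Peeling one coordinate off the block sum -/

/-- Clamping `x : ℕ` into `Fin (N+1)` (monotone). [folklore] -/
private def clampFin (N x : ℕ) : Fin (N + 1) := ⟨min x N, by omega⟩

/-- Clamping does nothing below `N`. [folklore] -/
private theorem clampFin_of_le {N x : ℕ} (hx : x ≤ N) : (clampFin N x : ℕ) = x := by
  simp [clampFin, hx]

/-- Clamping is monotone. [folklore] -/
private theorem clampFin_mono (N : ℕ) {x x' : ℕ} (h : x ≤ x') : clampFin N x ≤ clampFin N x' := by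
  show min x N ≤ min x' N
  exact min_le_min_right N h

omit [Fintype κ] in
/-- Updating one coordinate is monotone in the configuration. [folklore] -/
private theorem update_mono_left (i : κ) (v : Fin (N + 1)) {y y' : κ → Fin (N + 1)} (h : y ≤ y') :
    update y i v ≤ update y' i v := by
  intro j
  by_cases hj : j = i
  · subst hj; simp
  · rw [update_of_ne hj, update_of_ne hj]; exact h j

omit [Fintype κ] in
/-- Updating one coordinate is monotone in the new value. [folklore] -/
private theorem update_mono_right (i : κ) (y : κ → Fin (N + 1)) {v v' : Fin (N + 1)} (h : v ≤ v') :
    update y i v ≤ update y i v' := by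
  intro j
  by_cases hj : j = i
  · subst hj; simpa
  · rw [update_of_ne hj, update_of_ne hj]

/-- **Peeling identity.**  For `i ∉ K` and weights vanishing above `N`:
`(Σ_v w_i v) · L_{K ∪ {i}}(Φ, σ) = Σ_{x ≤ σ} w_i(x) · L_K(Φ(· with y_i := x), σ − x)`. [folklore] -/
private theorem laySum_insert (w : κ → ℕ → ℝ) (hwN : ∀ j n, N < n → w j n = 0) {K : Finset κ} {i : κ} (hi : i ∉ K)
    (Φ : (κ → Fin (N + 1)) → ℝ) (σ : ℕ) :
    (∑ v : Fin (N + 1), w i v) * laySum N w (insert i K) Φ σ =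
      ∑ x ∈ range (σ + 1), w i x * laySum N w K (fun y => Φ (update y i (clampFin N x))) (σ - x) := by
  -- split the layer of `K ∪ {i}` according to the value `v = y_i`
  have split : laySum N w (insert i K) Φ σ =
      ∑ v : Fin (N + 1), ∑ y, (if y i = v then piWeight N w y *
        ((if blockSum K y + v = σ then (1 : ℝ) else 0) * Φ (update y i v)) else 0) := by
    rw [laySum, ← Finset.sum_fiberwise univ (fun y : κ → Fin (N + 1) => y i)]
    refine sum_congr rfl fun v _ => ?_
    rw [sum_filter]
    refine sum_congr rfl fun y _ => ?_
    by_cases hy : y i = v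
    · rw [if_pos hy, if_pos hy, blockSum, sum_insert hi, ← hy, update_eq_self]
      by_cases hs : (y i : ℕ) + ∑ j ∈ K, (y j : ℕ) = σ
      · rw [if_pos hs, if_pos (by rw [blockSum]; omega), one_mul]
      · rw [if_neg hs, if_neg (by rw [blockSum]; omega), zero_mul, mul_zero]
    · rw [if_neg hy, if_neg hy]
  rw [split, mul_sum]
  -- each fibre by the slice identity
  have fibre : ∀ v : Fin (N + 1), (∑ u : Fin (N + 1), w i u) * ∑ y, (if y i = v then piWeight N w y *
      ((if blockSum K y + v = σ then (1 : ℝ) else 0) * Φ (update y i v)) else 0) =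
      w i v * (if (v : ℕ) ≤ σ then laySum N w K (fun y => Φ (update y i (clampFin N v))) (σ - v) else 0) := by
    intro v
    have hcv : clampFin N (v : ℕ) = v := Fin.ext (clampFin_of_le (Nat.lt_succ_iff.1 v.2))
    simp only [hcv]
    rw [slice_sum w i _ (fun y u => by simp only [update_idem, blockSum_update_of_not_mem hi])]
    congr 1
    by_cases hv : (v : ℕ) ≤ σ
    · rw [if_pos hv, laySum]
      refine sum_congr rfl fun y _ => ?_
      by_cases hs : blockSum K y = σ - v
      · rw [if_pos hs, if_pos (by omega), one_mul]
      · rw [if_neg hs, if_neg (by omega), zero_mul, mul_zero]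
    · rw [if_neg hv]
      exact sum_eq_zero fun y _ => by rw [if_neg (by omega), zero_mul, mul_zero]
  rw [sum_congr rfl fun v _ => fibre v]
  -- pass from `v : Fin (N+1)` to `x ∈ range (σ+1)` (the terms with `x > N` vanish by `hwN`)
  rw [Fin.sum_univ_eq_sum_range (fun x => w i x *
    (if x ≤ σ then laySum N w K (fun y => Φ (update y i (clampFin N x))) (σ - x) else 0)) (N + 1)]
  · have lhs : ∑ x ∈ range (N + 1), w i x * (if x ≤ σ then laySum N w K (fun y => Φ (update y i (clampFin N x))) (σ - x) else 0)
        = ∑ x ∈ (range (N + 1)).filter (· ≤ σ), w i x * laySum N w K (fun y => Φ (update y i (clampFin N x))) (σ - x) := by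
      rw [sum_filter]; exact sum_congr rfl fun x _ => by split_ifs <;> simp
    have rhs : ∑ x ∈ range (σ + 1), w i x * laySum N w K (fun y => Φ (update y i (clampFin N x))) (σ - x)
        = ∑ x ∈ (range (σ + 1)).filter (· ≤ N), w i x * laySum N w K (fun y => Φ (update y i (clampFin N x))) (σ - x) := by
      rw [sum_filter]
      refine sum_congr rfl fun x _ => ?_
      split_ifs with hx
      · rfl
      · rw [hwN i x (by omega), zero_mul]
    rw [lhs, rhs]
    exact sum_congr (by ext x; simp only [mem_filter, mem_range]; omega) fun _ _ => rfl

/-! ### The induction on the set of summed coordinates -/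

/-- Chaining consecutive layer comparisons along an interval support. [folklore] -/
private theorem chain_of_step (E n : ℕ → ℝ) (hn : IsLogConcaveSeq n) (hEz : ∀ σ, n σ = 0 → E σ = 0)
    (hstep : ∀ σ, E σ * n (σ + 1) ≤ E (σ + 1) * n σ) {σ σ' : ℕ} (h : σ ≤ σ') : E σ * n σ' ≤ E σ' * n σ := by
  induction σ', h using Nat.le_induction with
  | base => exact le_rfl
  | succ σ' hσσ' ih =>
    -- cases on whether the middle layer `σ'` is empty
    rcases (hn.1 σ').lt_or_eq with hpos | hzero
    · -- multiply the two comparisons and cancel `n σ' > 0`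
      have h1 := mul_le_mul_of_nonneg_right ih (hn.1 (σ' + 1))
      have h2 := mul_le_mul_of_nonneg_right (hstep σ') (hn.1 σ)
      nlinarith [h1, h2, hpos, hn.1 σ, hn.1 (σ' + 1)]
    · -- `n σ' = 0`: then `n σ = 0` or `n (σ'+1) = 0` (interval support)
      by_cases hσ : n σ = 0
      · rw [hσ, hEz σ hσ, zero_mul, mul_zero]
      · have hσ1 : n (σ' + 1) = 0 := by
          by_contra h1
          have := hn.pos_of_mem_Icc (lt_of_le_of_ne (hn.1 σ) (Ne.symm hσ)) (lt_of_le_of_ne (hn.1 _) (Ne.symm h1)) hσσ'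
            (Nat.le_succ σ')
          rw [← hzero] at this; exact lt_irrefl 0 this
        rw [hσ1, hEz _ hσ1, mul_zero, zero_mul]

/-- The inductive statement: monotone conditional means AND log-concave layer masses, for every set `K` of summed
coordinates (weights `PF₂`, vanishing above `N`; `Φ ≥ 0` monotone). [cite: Efron1965, Thm 1; SaumardWellner2014, Prop. 6.3] -/
private theorem efron_aux (w : κ → ℕ → ℝ) (hw : ∀ j, IsLogConcaveSeq (w j)) (hwN : ∀ j n, N < n → w j n = 0) (K : Finset κ) :
    (∀ Φ : (κ → Fin (N + 1)) → ℝ, Monotone Φ → (∀ y, 0 ≤ Φ y) →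
        ∀ σ σ', σ ≤ σ' → laySum N w K Φ σ * laySum N w K (fun _ => 1) σ' ≤ laySum N w K Φ σ' * laySum N w K (fun _ => 1) σ) ∧
      IsLogConcaveSeq (laySum N w K (fun _ => 1)) := by
  have hw0 : ∀ j n, 0 ≤ w j n := fun j => (hw j).1
  induction K using Finset.induction_on with
  | empty =>
    -- only the layer `σ = 0` is nonempty
    have hL : ∀ (Ψ : (κ → Fin (N + 1)) → ℝ) (σ : ℕ), σ ≠ 0 → laySum N w ∅ Ψ σ = 0 := fun Ψ σ hσ =>
      sum_eq_zero fun y _ => by rw [if_neg]; rw [blockSum, sum_empty]; exact Ne.symm hσ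
    refine ⟨fun Φ _ _ σ σ' h => ?_, ?_⟩
    · by_cases hσ' : σ' = 0
      · obtain rfl : σ = 0 := by omega
        subst hσ'; exact le_rfl
      · rw [hL _ σ' hσ', hL Φ σ' hσ', mul_zero, zero_mul]
    · have e : laySum N w ∅ (fun _ => 1) = fun σ => if σ = 0 then laySum N w ∅ (fun _ => 1) 0 else 0 := by
        funext σ; split_ifs with h
        · rw [h]
        · exact hL _ σ h
      rw [e]; exact isLogConcaveSeq_delta (laySum_nonneg hw0 ∅ (fun _ => zero_le_one) 0)
  | insert i K hi ih =>
    obtain ⟨ih1, ih2⟩ := ih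
    set Z : ℝ := ∑ v : Fin (N + 1), w i v with hZ
    have hZ0 : 0 ≤ Z := sum_nonneg fun v _ => hw0 i v
    set nK : ℕ → ℝ := laySum N w K (fun _ => 1) with hnK
    -- the new layer masses are `(w_i ⋆ n_K)/Z`
    have conv1 : ∀ σ, Z * laySum N w (insert i K) (fun _ => 1) σ = seqConv (w i) nK σ := fun σ => by
      rw [laySum_insert w hwN hi, seqConv_def]
    have lc_conv : IsLogConcaveSeq (seqConv (w i) nK) := isLogConcaveSeq_seqConv (hw i) ih2
    have part2 : IsLogConcaveSeq (laySum N w (insert i K) (fun _ => 1)) := by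
      rcases hZ0.lt_or_eq with hZpos | hZzero
      · have e : laySum N w (insert i K) (fun _ => 1) = fun σ => Z⁻¹ * seqConv (w i) nK σ := by
          funext σ; rw [← conv1 σ, ← mul_assoc, inv_mul_cancel₀ hZpos.ne', one_mul]
        rw [e]; exact lc_conv.const_mul (inv_nonneg.2 hZ0)
      · -- `Z = 0`: all weights `w i v` vanish, so every layer sum is `0`
        have hw0' : ∀ v : Fin (N + 1), w i v = 0 := fun v =>
          (sum_eq_zero_iff_of_nonneg (fun (u : Fin (N + 1)) _ => hw0 i u)).1 (by rw [← hZ]; exact hZzero.symm) v (mem_univ v)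
        have e : laySum N w (insert i K) (fun _ => 1) = fun _ => 0 := by
          funext σ; refine sum_eq_zero fun y _ => ?_
          split_ifs
          · rw [piWeight_eq_mul_erase w i y, hw0', zero_mul, zero_mul]
          · rfl
        rw [e]; exact ⟨fun _ => le_rfl, fun _ _ _ _ _ _ _ => by simp⟩
    refine ⟨fun Φ hΦ hΦ0 σ σ' hσσ' => ?_, part2⟩
    -- the `A`-family for the two-variable step
    set A : ℕ → ℕ → ℝ := fun x u => laySum N w K (fun y => Φ (update y i (clampFin N x))) u with hA
    have hmonoΦx : ∀ x, Monotone (fun y => Φ (update y i (clampFin N x))) := fun x y y' h =>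
      hΦ (update_mono_left i _ h)
    have hAu : ∀ x u u', u ≤ u' → A x u * nK u' ≤ A x u' * nK u := fun x u u' huu' =>
      ih1 _ (hmonoΦx x) (fun y => hΦ0 _) u u' huu'
    have hAx : ∀ x x' u, x ≤ x' → A x u ≤ A x' u := fun x x' u hxx' =>
      laySum_mono hw0 K (fun y => hΦ (update_mono_right i y (clampFin_mono N hxx'))) u
    have hAz : ∀ x u, nK u = 0 → A x u = 0 := fun x u hu => laySum_eq_zero_of_one hw0 K _ hu
    have convA : ∀ τ, Z * laySum N w (insert i K) Φ τ = ∑ x ∈ range (τ + 1), w i x * A x (τ - x) := fun τ =>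
      laySum_insert w hwN hi Φ τ
    -- consecutive layers by Efron's two-variable step, then chain
    obtain ⟨E, hE⟩ : ∃ E : ℕ → ℝ, ∀ τ, E τ = ∑ x ∈ range (τ + 1), w i x * A x (τ - x) := ⟨_, fun _ => rfl⟩
    have step : ∀ τ, E τ * seqConv (w i) nK (τ + 1) ≤ E (τ + 1) * seqConv (w i) nK τ := fun τ => by
      rw [hE, hE, seqConv_def, seqConv_def, show τ + 1 + 1 = τ + 2 from rfl]
      exact efron_two_step A (hw i) ih2 hAz hAu hAx τ
    have hEz : ∀ τ, seqConv (w i) nK τ = 0 → E τ = 0 := by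
      intro τ hτ
      rw [seqConv_def] at hτ
      have hterm := (sum_eq_zero_iff_of_nonneg (fun x _ => mul_nonneg (hw0 i x) (ih2.1 _))).1 hτ
      rw [hE]
      refine sum_eq_zero fun x hx => ?_
      rcases mul_eq_zero.1 (hterm x hx) with h | h
      · rw [h, zero_mul]
      · rw [hAz x _ h, mul_zero]
    have chained := chain_of_step E _ lc_conv hEz step hσσ'
    -- undo the factor `Z`
    rcases hZ0.lt_or_eq with hZpos | hZzero
    · have eq1 : E σ * seqConv (w i) nK σ' =
          Z * Z * (laySum N w (insert i K) Φ σ * laySum N w (insert i K) (fun _ => 1) σ') := by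
        rw [hE, ← convA, ← conv1]; ring
      have eq2 : E σ' * seqConv (w i) nK σ =
          Z * Z * (laySum N w (insert i K) Φ σ' * laySum N w (insert i K) (fun _ => 1) σ) := by
        rw [hE, ← convA, ← conv1]; ring
      rw [eq1, eq2] at chained
      exact le_of_mul_le_mul_left chained (mul_pos hZpos hZpos)
    · have hw0' : ∀ v : Fin (N + 1), w i v = 0 := fun v =>
        (sum_eq_zero_iff_of_nonneg (fun (u : Fin (N + 1)) _ => hw0 i u)).1 (by rw [← hZ]; exact hZzero.symm) v (mem_univ v)
      have e : ∀ (Ψ : (κ → Fin (N + 1)) → ℝ) τ, laySum N w (insert i K) Ψ τ = 0 := fun Ψ τ =>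
        sum_eq_zero fun y _ => by
          split_ifs
          · rw [piWeight_eq_mul_erase w i y, hw0', zero_mul, zero_mul]
          · rfl
      simp only [e, mul_zero, le_refl]

/-- **Efron's monotonicity theorem** (discrete, division-free form).  Let `X_j`, `j ∈ κ`, be independent random variables with values in
`{0,…,N}` and `PF₂` (log-concave, no internal zeros) weights `w_j`, and let `Φ` be coordinatewise non-decreasing.  Then for every set `K`
of coordinates, `σ ↦ E[Φ(X) ∣ Σ_{j∈K} X_j = σ]` is non-decreasing on the support of the block sum; cross-multiplied:
`L_K(Φ, σ) · L_K(1, σ') ≤ L_K(Φ, σ') · L_K(1, σ)` for `σ ≤ σ'`.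
[cite: Efron1965, Thm 1 and Remark p. 278 (integer-valued case); SaumardWellner2014, Thm 6.1, Rem. 6.2, Prop. 6.3] -/
theorem efron_laySum_mul_le (w : κ → ℕ → ℝ) (hw : ∀ j, IsLogConcaveSeq (w j)) (K : Finset κ)
    (Φ : (κ → Fin (N + 1)) → ℝ) (hΦ : Monotone Φ) {σ σ' : ℕ} (hσσ' : σ ≤ σ') :
    laySum N w K Φ σ * laySum N w K (fun _ => 1) σ' ≤ laySum N w K Φ σ' * laySum N w K (fun _ => 1) σ := by
  -- truncate the weights above `N` (does not change any layer sum) and shift `Φ` to be nonnegative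
  set w' : κ → ℕ → ℝ := fun j n => if n ≤ N then w j n else 0 with hw'
  have hw'lc : ∀ j, IsLogConcaveSeq (w' j) := fun j => (hw j).truncLE N
  have hw'N : ∀ j n, N < n → w' j n = 0 := fun j n hn => by simp only [hw']; rw [if_neg (by omega)]
  have hL : ∀ (Ψ : (κ → Fin (N + 1)) → ℝ) τ, laySum N w K Ψ τ = laySum N w' K Ψ τ := fun Ψ τ =>
    sum_congr rfl fun y _ => by
      have : piWeight N w y = piWeight N w' y := prod_congr rfl fun j _ => by
        simp only [hw']; rw [if_pos (Nat.lt_succ_iff.1 (y j).2)]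
      rw [this]
  set c : ℝ := Φ (fun _ => 0) with hc
  have hΦc : ∀ y, 0 ≤ Φ y - c := fun y => sub_nonneg.2 (hΦ fun j => Fin.zero_le _)
  have key := (efron_aux w' hw'lc hw'N K).1 (fun y => Φ y - c) (fun y y' h => sub_le_sub_right (hΦ h) c) hΦc σ σ' hσσ'
  rw [laySum_sub_const, laySum_sub_const, ← hL, ← hL, ← hL, ← hL] at key
  nlinarith [key]

/-- The law of a sum of independent `PF₂` variables is `PF₂`: the layer masses `σ ↦ L_K(1, σ)` form a log-concave sequence without
internal zeros. [cite: Efron1965, §1; SaumardWellner2014, Prop. 6.3 (proof); Karlin1968, Ch. 8 §1] -/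
theorem isLogConcaveSeq_laySum_one (w : κ → ℕ → ℝ) (hw : ∀ j, IsLogConcaveSeq (w j)) (K : Finset κ) :
    IsLogConcaveSeq (laySum N w K (fun _ => 1)) := by
  set w' : κ → ℕ → ℝ := fun j n => if n ≤ N then w j n else 0 with hw'
  have hw'lc : ∀ j, IsLogConcaveSeq (w' j) := fun j => (hw j).truncLE N
  have hw'N : ∀ j n, N < n → w' j n = 0 := fun j n hn => by simp only [hw']; rw [if_neg (by omega)]
  have hL : laySum N w K (fun _ => 1) = laySum N w' K (fun _ => 1) := by
    funext τ
    exact sum_congr rfl fun y _ => by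
      have : piWeight N w y = piWeight N w' y := prod_congr rfl fun j _ => by
        simp only [hw']; rw [if_pos (Nat.lt_succ_iff.1 (y j).2)]
      rw [this]
  rw [hL]; exact (efron_aux w' hw'lc hw'N K).2

/-- **Efron's theorem, covariance form under an arbitrary tilt of the block sum.**  For weights `ω ≥ 0` on the values of the block sum
and a threshold `c`: `(Σ_{s<c} ω_s L_K(Φ,s))·(Σ_{s≤M} ω_s L_K(1,s)) ≤ (Σ_{s<c} ω_s L_K(1,s))·(Σ_{s≤M} ω_s L_K(Φ,s))` (`c ≤ M+1`), i.e.
`E[Φ ∣ S < c] ≤ E[Φ]` under the law reweighted by `ω(S)` — monotone conditional means give nonnegative correlation with `1[S ≥ c]`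
(Chebyshev). [cite: Efron1965, Thm 1 (Cor.); SaumardWellner2014, Thm 6.1] -/
theorem efron_prefix_mul_le (w : κ → ℕ → ℝ) (hw : ∀ j, IsLogConcaveSeq (w j)) (K : Finset κ)
    (Φ : (κ → Fin (N + 1)) → ℝ) (hΦ : Monotone Φ) (ω : ℕ → ℝ) (hω : ∀ s, 0 ≤ ω s) {c M : ℕ} (hc : c ≤ M + 1) :
    (∑ s ∈ range c, ω s * laySum N w K Φ s) * (∑ s ∈ range (M + 1), ω s * laySum N w K (fun _ => 1) s) ≤
      (∑ s ∈ range c, ω s * laySum N w K (fun _ => 1) s) * (∑ s ∈ range (M + 1), ω s * laySum N w K Φ s) :=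
  sum_range_mul_sum_le_of_mlr (fun s => ω s * laySum N w K (fun _ => 1) s) (fun s => ω s * laySum N w K Φ s) hc
    (fun s s' hs hs' _ => by
      have := mul_le_mul_of_nonneg_left (efron_laySum_mul_le w hw K Φ hΦ (show s ≤ s' by omega)) (mul_nonneg (hω s) (hω s'))
      nlinarith [this])

end Multi

end Literature.Probability.Distributions
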